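import Summits.QuantumFields.YangMills.Theorems.AlphaInputsT3ACv3OldTermRowsOfShape43
import HarnessLib

/-!
# `AlphaInputsT3ACv3Bound28RowOfLetters` — THE DOOR «(α) row `bound28` ⟸ the chart-configuration identification letter + the top-level plaquette letter + smallness»,
# ON THE TORUS CARRIER OF RECORD (cell `ym3-torus`, ★★OWNER g35 word 2026-08-30 11:52Z «GO (G4) #7 `bound28`»; seat `ym-line-cst-p1` g37, free hand;
# `--supports stmt-QuantumFields-19936 --as helper`; companion of ✓`AlphaInputsT3ACv3OldTermRowsOfShape43` (door (G2), rows #18–19))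

THE ROW (NODE-O bill #7, id D-28; field `.bound28` of `AlphaV3AC.StepDataV3CoreAC` = `…v3DataSchemaChi.lean` :104 = `…v3Lane.lean` :98, hence of the `k`-th `StepDataV3ChiAC`
conjunct of the (O‴χₛ) stub `DataRowsT3XsChiSel` of `HistoryTailL` (19936), registry v6 `stub_selXsV4DataRows`):

    bound28 : ∀ Y h U, ‖(𝔖 k).Bcfg Y h U‖ ≤ 𝔠.cB * (rFun 𝔠.r₀ (S.gk k) * S.gk k * pFun 𝔠.b₀ 𝔠.p₀ (S.gk k))

i.e. [Balaban1985UV3] (28) p.263 — «The characteristic functions χ₁ defined in (13) give the restrictions |V(∂p′) − 1| < 2L²g₀p(g₀), hence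
|B(c)| < 4L²|c₋ − y|g₀p(g₀) < 8L²3R₁M₁r(g₀)g₀p(g₀), (28) and for g₀ sufficiently small the number on the right-hand side above is small» — for the ∃-bound background chart
configurations `Bcfg Y h U : PBond S.P k → 𝔤ᶜ` («the configuration B restricted to □₁», (27): `B(c) = (1∕i) log V(Γ_{y,c₋} ∪ c ∪ Γ_{c₊,y})`, `y` the centre of the cube `□ ∋ Y`) in the SUP
norm over the bonds, at EVERY localisation `Y`, history `h`, coarse field `U`.

LOCATE (six lines, per the OWNER's word; px8 g16's 19936 evidence #43 classed #7 «M after B0 + B1»).  PRINT: (27)–(28) p.263, inputs = the axial comb contours of [Balaban1985Averaging]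
pp.24–25 and the (13)∕(40)-window on the plaquettes near `□₁`.  CARRIERS ✓ on the torus: `B10Eq27TorusAxialLog.B27T` (:398, (27) with body), `norm_B27T_le` (:501, (28) first member:
`‖B27T V y c‖ ≤ 2·|c₋ − y|₁·α`), `eq28T_specialUnitaryGroup` (:825, both members for `SU(N)`), and the dictionary `|c₋ − y|₁ = tdist` ∕ box lemmas of ✓`…OldTermRowsOfShape43` §0.
GAP: (G1) `Bcfg` is free `StepSeries` data (zero series: `Bcfg = 0` meets the row at sight) — the identification `‖Bcfg Y h U c‖ ≤ ‖B27T (Vtop h U) (ctr Y) c‖` with support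
`tdist c.src (ctr Y) ≤ Rad` is B0 OUTPUT (D-class); (G2) the plaquette letter `‖Vtop(∂⟨ctr Y + z; κ, μ⟩) − 1‖ ≤ α` on the `(Rad+1)`-box = the χₛ class's `reg68LevelsSet` clause at the top
pair of levels (threshold `C68·g_k p(g_k)`; print `α = 2L²g_kp(g_k)`), BY NAME once the constants are knit; (G3) the numerals: `Rad·α ≤ ½` (print's «g₀ sufficiently small») and
`2·Rad·α ≤ cB·r(g_k)·g_k·p(g_k)` (print: `Rad = 2·3R₁M₁r(g_k)`, `α = 2L²g_kp(g_k)`, `cB = 24L²R₁M₁`).  No analytic estimate remains: the row is D-class + numerals, GIVEN the window.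

WHAT THIS FILE PROVES (theorems only; 0 `def`, 0 `sorry`; nothing conclusion-shaped among the hypotheses).
* §1 ★ `norm_B27T_le_of_tdist_le` — ON ONE TORUS LEVEL: for a unit-valued `V : GaugeField P j 𝔸ˣ`, a centre `y`, a radius `R`, a threshold `α ≥ 0` with the plaquettes
  `⟨y + z; κ, μ⟩`, `z ∈ [−(R+1), R+1]^d`, within `α` of `1` and `R·α ≤ ½`: every bond `c` with `tdist c.src y ≤ R` has `‖B27T V y c‖ ≤ 2·R·α` (✓`norm_B27T_le` + §0 of the companion).
* §2 ★★★ `bound28_of_letters` — THE SOCKET EDITION: in the variable context of `StepDataV3CoreAC 𝔊 𝔠 X 𝔖 𝔄 win k` (any group model, any `AlphaConsts`, any data `𝔖`), from the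
  identification letter `hid` + support `hsupp` (D-class, B0 output: `Bcfg Y h U c` is `B27T` of the top field `Vtop h U := unitsField (toUField (avg^k (UkH (k+1) h U)))` based at the
  cube centre `ctr Y`, read in `𝔤ᶜ`, zero off the cube), `Vtop` unit-valued, the plaquette letter `hplaq` on the box about `ctr Y` for LIVE `Y` (χₛ: `reg68LevelsSet`), the smallness
  `hsmall : Rad·α ≤ ½` and the constants knit `hknit : 2·Rad·α ≤ cB·(r(g_k)·g_k·p(g_k))` — THE CONCLUSION IS THE FIELD TYPE OF `.bound28` VERBATIM (docks by field projection ∕ `exact`).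
NON-VACUITY (honest): the zero `StepSeries` (`Bcfg = 0`) inhabits every letter AND the row; the door's content is at a live chart configuration — e.g. `Bcfg Y h U c := B27T V y c` read in
`𝔤ᶜ` for a non-flat `V`: then (28) is NOT automatic and §1 computes it from the plaquettes through the axial ladder.
HONEST SCOPE: a door; (α) data rows 0∕23 unchanged; `bound28` as a data row on `𝔖_Bal` remains blocked on B0 (the object) and on the window (B1); nothing of (O‴χₛ), `HistoryTailL` (19936),
EX, `YM3TorusSU2` (R3 — SU(2) YM₃ on T³, a RECORD rung: NOT d = 4, NOT infinite volume, NOT a mass gap, NOT Clay) is proved; the Yang–Mills mass gap is NOT proved.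

References: T. Bałaban, Commun. Math. Phys. **102** (1985) 255–275 [Balaban1985UV3] ((27)–(28) p.263, (13) p.259); Commun. Math. Phys. **98** (1985) 17–51 [Balaban1985Averaging]
(pp.24–25, the axial ladder «|A_b| < 2|b₋ − y|α₀»).
-/

set_option autoImplicit false

noncomputable section

namespace Summit.QuantumFields.YangMills.Theorems.AlphaV3Bound28RowOfLetters

open scoped BigOperators
open Literature.MathematicalPhysics.QuantumFieldTheory.Balaban1983to89
open Literature.MathematicalPhysics.QuantumFieldTheory.Balaban1983to89.B10Eq27TorusAxialLog (transl rel holT B27T norm_B27T_le)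
open B7Prop1Explicit renaming Site → LSite
open B7Prop1Explicit (e l1 U1 plaqWord)
open B7Prop1Local (InBox PlaqIn)
open Summit.QuantumFields.YangMills.Theorems.AlphaV3OldTermRowsOfShape43 (l1_rel_eq_tdist inBox_zero inBox_rel_of_tdist_le inBox_rel_add_e_of_tdist_le)

/-! ## §1 (28) on one torus level: the loop variables within radius `R` of the centre -/

section OneLevel

variable {P : Params} {j : ℕ} {𝔸 : Type*} [NormedRing 𝔸] [NormOneClass 𝔸] [NormedAlgebra ℂ 𝔸] [CompleteSpace 𝔸]

/-- ★ **(28), FIRST MEMBER, UNIFORMLY ON THE BALL OF RADIUS `R` ABOUT THE CENTRE** ([Balaban1985UV3] p.263: «|B(c)| < 4L²|c₋ − y|g₀p(g₀) < …»): for a unit-valued `V` on the bonds of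
`T^{(j)}`, if the plaquettes `⟨y + z; κ, μ⟩` with `z ∈ [−(R+1), R+1]^d` are within `α ≥ 0` of `1` and `R·α ≤ ½`, then `‖B27T V y c‖ ≤ 2·R·α` at every bond `c` with `tdist(c₋, y) ≤ R`
(✓`norm_B27T_le`: `≤ 2|c₋ − y|₁α`, and `|c₋ − y|₁ = tdist ≤ R`). [cite: Balaban1985UV3, (28) p.263; Balaban1985Averaging, pp.24–25] -/
theorem norm_B27T_le_of_tdist_le (V : GaugeField P j 𝔸ˣ) (hV : ∀ b, V b ∈ U1 𝔸) (y : Site P j) (R : ℕ) {α : ℝ} (hα : 0 ≤ α)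
    (hplaq : ∀ (z : LSite P.d) (κ μ : Fin P.d), κ ≠ μ → PlaqIn (fun _ : Fin P.d => -((R : ℤ) + 1)) (fun _ => (R : ℤ) + 1) (z, κ, μ) →
      ‖((holT V (transl y z) (plaqWord κ μ) : 𝔸ˣ) : 𝔸) - 1‖ ≤ α)
    (hsmall : (R : ℝ) * α ≤ 1 / 2) (c : PBond P j) (hc : Site.tdist c.src y ≤ R) :
    ‖B27T V y c‖ ≤ 2 * ((R : ℝ) * α) := by
  have hl1 : (l1 (rel y c.src) : ℝ) = Site.tdist c.src y := by exact_mod_cast l1_rel_eq_tdist y c.src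
  have hle : (l1 (rel y c.src) : ℝ) ≤ R := by rw [hl1]; exact_mod_cast hc
  have hsm : (l1 (rel y c.src) : ℝ) * α ≤ 1 / 2 := (mul_le_mul_of_nonneg_right hle hα).trans hsmall
  have h := norm_B27T_le (lo := fun _ : Fin P.d => -((R : ℤ) + 1)) (hi := fun _ => (R : ℤ) + 1)
    (fun _ => by linarith [(Nat.cast_nonneg R : (0 : ℤ) ≤ R)]) V hV y hplaq hα (inBox_zero R) c
    (inBox_rel_of_tdist_le y c.src hc) (inBox_rel_add_e_of_tdist_le y c.src c.dir hc) hsm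
  exact h.trans (by nlinarith)

end OneLevel

/-! ## §2 The socket edition: the FIELD TYPE of `StepDataV3CoreAC.bound28`, from the letters -/

section Socket

open Literature.MathematicalPhysics.QuantumFieldTheory.Balaban1983to89.B10 (pFun pFun_nonneg rFun)
open Literature.MathematicalPhysics.QuantumFieldTheory.Balaban1983to89.TreeLengthTorus (tsys)
open Literature.MathematicalPhysics.QuantumFieldTheory.Balaban1985CMP102
open Literature.MathematicalPhysics.QuantumFieldTheory.Balaban1985CMP102.Setting
open Summit.QuantumFields.Balaban3D.Carriers
open Summit.QuantumFields.Balaban3D.Proofs.Primitives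
open Summit.QuantumFields.Balaban3D.Proofs.GroupModelLieC (lieC)
open Summit.QuantumFields.Balaban3D.Proofs.ScalesArithmetic (gk_pos gk_le_one)
open Summit.QuantumFields.Balaban3D.Proofs.VacuumAndBooking (rFun_nonneg)

variable {L : ℕ} {S : Scales L} {G : Type} [GaugeGroup G] [MeasurableSpace G] [HaarData G] (𝔊 : GroupModel G) (𝔠 : AlphaConsts L 𝔊.N)
  (𝔖 : ∀ k, StepSeries S G ↥(lieC 𝔊) (nblkOf S 𝔠.lane.carrier k) k) (k : ℕ)
  {𝔸 : Type*} [NormedRing 𝔸] [NormOneClass 𝔸] [NormedAlgebra ℂ 𝔸] [CompleteSpace 𝔸]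
  (ctr : (tsys 3 (nblkOf S 𝔠.lane.carrier k)).Dom → Site S.P k)
  (Vtop : Hist S.P (k + 1) → GaugeField S.P (k + 1) G → GaugeField S.P k 𝔸ˣ) (Rad : ℕ) (α : ℝ)

/-- ★★★ **ROW `bound28` OF `StepDataV3CoreAC` FROM THE LETTERS** — conclusion = the field type of `.bound28` VERBATIM (`…v3DataSchemaChi.lean` :104 = `…v3Lane.lean` :98).  Letters:
`hid : ‖(𝔖 k).Bcfg Y h U c‖ ≤ ‖B27T (Vtop h U) (ctr Y) c‖` and `hsupp : Bcfg Y h U c ≠ 0 → tdist c.src (ctr Y) ≤ Rad` (D-class identification, B0 OUTPUT: (27) restricted to the cube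
`□₁` about the centre `ctr Y` of `□ ∋ Y`); `hV : Vtop h U` unit-valued; `hplaq` the top-level plaquette letter at threshold `α ≥ 0` on the `(Rad+1)`-box about `ctr Y` for every LIVE `Y`
((13)∕(40)-window; χₛ: `reg68LevelsSet`; print `α = 2L²g_kp(g_k)`); `hsmall : Rad·α ≤ ½` and the constants knit `hknit : 2·Rad·α ≤ cB·(r(g_k)·g_k·p(g_k))` (print: `Rad = 2·3R₁M₁r`,
`cB = 24L²R₁M₁`); `hk : k + 1 ≤ S.K` (the socket's range, for `0 ≤ r(g_k), p(g_k)`).  Proof: sup norm over the bonds = `pi_norm_le_iff_of_nonneg`; dead bonds are `0`; live bonds by §1.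
[cite: Balaban1985UV3, (28) p.263] -/
theorem bound28_of_letters (hk : k + 1 ≤ S.K) (hα : 0 ≤ α)
    (hid : ∀ (Y : (tsys 3 (nblkOf S 𝔠.lane.carrier k)).Dom) (h : Hist S.P (k + 1)) (U : GaugeField S.P (k + 1) G) (c : PBond S.P k),
      ‖(𝔖 k).Bcfg Y h U c‖ ≤ ‖B27T (Vtop h U) (ctr Y) c‖)
    (hsupp : ∀ (Y : (tsys 3 (nblkOf S 𝔠.lane.carrier k)).Dom) (h : Hist S.P (k + 1)) (U : GaugeField S.P (k + 1) G) (c : PBond S.P k),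
      (𝔖 k).Bcfg Y h U c ≠ 0 → Site.tdist c.src (ctr Y) ≤ Rad)
    (hV : ∀ (h : Hist S.P (k + 1)) (U : GaugeField S.P (k + 1) G) (b : PBond S.P k), Vtop h U b ∈ U1 𝔸)
    (hplaq : ∀ (Y : (tsys 3 (nblkOf S 𝔠.lane.carrier k)).Dom) (h : Hist S.P (k + 1)) (U : GaugeField S.P (k + 1) G),
      (∃ c : PBond S.P k, (𝔖 k).Bcfg Y h U c ≠ 0) →
      ∀ (z : LSite S.P.d) (κ μ : Fin S.P.d), κ ≠ μ → PlaqIn (fun _ : Fin S.P.d => -((Rad : ℤ) + 1)) (fun _ => (Rad : ℤ) + 1) (z, κ, μ) →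
        ‖((holT (Vtop h U) (transl (ctr Y) z) (plaqWord κ μ) : 𝔸ˣ) : 𝔸) - 1‖ ≤ α)
    (hsmall : (Rad : ℝ) * α ≤ 1 / 2)
    (hknit : 2 * ((Rad : ℝ) * α) ≤ 𝔠.cB * (rFun 𝔠.r₀ (S.gk k) * S.gk k * pFun 𝔠.b₀ 𝔠.p₀ (S.gk k))) :
    ∀ Y h U, ‖(𝔖 k).Bcfg Y h U‖ ≤ 𝔠.cB * (rFun 𝔠.r₀ (S.gk k) * S.gk k * pFun 𝔠.b₀ 𝔠.p₀ (S.gk k)) := by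
  intro Y h U
  have hg0 : 0 < S.gk k := gk_pos S k
  have hg1 : S.gk k ≤ 1 := gk_le_one S S.gK_le_one k (by omega)
  have hrhs : 0 ≤ 𝔠.cB * (rFun 𝔠.r₀ (S.gk k) * S.gk k * pFun 𝔠.b₀ 𝔠.p₀ (S.gk k)) :=
    mul_nonneg 𝔠.cB_nonneg (mul_nonneg (mul_nonneg (rFun_nonneg 𝔠.r₀ (S.gk k) hg0 hg1) hg0.le)
      (pFun_nonneg 𝔠.b₀ 𝔠.p₀ (S.gk k) 𝔠.b₀_pos.le hg0 hg1))
  refine (pi_norm_le_iff_of_nonneg hrhs).2 fun c => ?_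
  by_cases hc : (𝔖 k).Bcfg Y h U c = 0
  · rw [hc, norm_zero]; exact hrhs
  · have h1 := norm_B27T_le_of_tdist_le (Vtop h U) (hV h U) (ctr Y) Rad hα (hplaq Y h U ⟨c, hc⟩) hsmall c (hsupp Y h U c hc)
    exact ((hid Y h U c).trans h1).trans hknit

end Socket

end Summit.QuantumFields.YangMills.Theorems.AlphaV3Bound28RowOfLetters

end
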